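import Literature.NumberTheory.Weil1964.ArchVacuumSection
import Literature.RepresentationTheory.KonnoKonno2007.JunctionContinuityRankOne
import HarnessLib

/-!
# The vacuum-normalised implementer section of the real unitary dual pair `U(P,Q) × U(R,S)` (Folland 1989 §4.2, Prop. (4.39); Knapp 2002 Thm 7.39; Konno–Konno 2007 §3.1)

Topic `RepresentationTheory/KonnoKonno2007`; namespaces `Literature.RepresentationTheory.KonnoKonno2007` (§1, generic in the
index type `σ`) and `Literature.RepresentationTheory.KonnoKonno2007.RealDualPair` (§§2–6).
Continuation of `Literature.NumberTheory.Weil1964.ArchVacuumSection` (the generic CANONICAL SECTION `vacSection γ g` of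
the implementer bundle of a symplectic action `γ` on `𝓢(ℝ^σ)`: the unique Heisenberg-covariant implementer of `γ g`
with a unitary `L²`-lift whose vacuum coefficient `⟪k₀, N k₀⟫` is a POSITIVE real, together with the interface
`KAKImplementerData` from which its joint continuity is derived) and of
`Literature.RepresentationTheory.KonnoKonno2007.JunctionContinuityRankOne` / `JunctionHyperbolicFamily` /
`RealUnitaryRankOneKAK` (the instance `G_∞ = Ginf P Q R S = UForm P Q × UForm R S → Sp(𝕎)` via `ι𝕎`, its maximal
compact `κ : DPK P Q R S → G_∞`, the hyperbolic implementer family `hypOp`, and the proper surjective `KAK` map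
`kakMapPair` for `|Q| = 1`, `kV R S` onto).

**The point of this file.**  NO representation `ω` of `G_∞` is assumed.  We prove that the implementer bundle of the
archimedean symplectic action `g ↦ ι𝕎 g` of the pair admits the `KAK` implementer data of `ArchVacuumSection`
(`kakImplementerData_junction`), hence that the canonical section

  `N := vacSection (fun g => ⇑(ι𝕎 P Q R S g)) : G_∞ → (𝓢 →L[ℂ] 𝓢)`

is, for `|Q| = 1` and `kV R S` onto (a definite second factor), a family of NON-ZERO operators (w0), JOINTLY
CONTINUOUS `G_∞ × 𝓢 → 𝓢` (w1), Heisenberg-covariant over `ι𝕎` (w2) with unitary `L²`-lifts (w2′), and equal to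
Folland's `μ₀ = unitaryOpPi ∘ dualPairι` on the maximal compact (`vacSection_junction_κ`).  These are exactly the three
hypotheses (w0)–(w2) on the auxiliary archimedean family `Winf` of the theta-majorant theorem
`Literature.NumberTheory.Weil1964.hasThetaMajorants_omega_comp`, at one real place, with no cocycle, no splitting and
no metaplectic homomorphism needed: the section `N` is in general NOT multiplicative (it is multiplicative up to the
unimodular Schur scalars), and nothing here claims it is.

The only analysis beyond the two imported files is the positivity of ONE Gaussian integral: the vacuum coefficient
of a Levi operator `L(a) f = |det a|^{-1/2} f ∘ a⁻¹` is `⟪h₀, L(a) h₀⟫ = |det a|^{-1/2} ∫ h₀(x) h₀(a⁻¹x) dx > 0`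
because `h₀ = 2^{n/4} e^{-π|x|²} > 0` (`vacCoeffS_leviS_ne_zero`); conjugating by the vacuum-fixing unitary `μ₀(u)`
of the frame (`hypOp = μ₀(u)⁻¹ ∘ hypLevi ∘ μ₀(u)`) does not change vacuum coefficients (`vacCoeffS_comp_comp`).

| Print | Content | Here |
|---|---|---|
| Folland 1989 §1.7 (1.72) | `h₀ = 2^{n/4} e^{-π x²} > 0` | `hermiteFun_herm_zero_eq`, `inner_vacL2_toL2_ne_zero_of_pos` |
| Folland 1989 (4.24) | Levi operators `|det a|^{-1/2} f(a⁻¹ x)` | `vacCoeffS_leviS_ne_zero`, `vacCoeffS_hypOp_ne_zero` |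
| Folland 1989 Prop. (4.39), Knapp 2002 Thm 7.39 | `μ₀` on `K`, `G = K A K` | `kakImplementerData_junction` |
| Konno–Konno 2007 §3.1 | the pair `U(V) × U(W) → Sp(𝕎)`, `ι𝕎 ∘ κ = realify ∘ dualPairι` | `vacSection_junction_κ` |

All statements are kernel-checked; citation tags record provenance only, and no statement of print is asserted as a
hypothesis.

## References

* [Folland1989] G. B. Folland, *Harmonic Analysis in Phase Space*, Princeton UP 1989: §1.7 (1.72); §4.2 (4.24), the
  Schur remark p. 156, Prop. (4.39) (doi:10.1515/9781400882427).
* [Knapp2002] A. W. Knapp, *Lie Groups Beyond an Introduction*, 2nd ed., Birkhäuser 2002: Theorem 7.39, p. 457.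
* [KonnoKonno2007] K. Konno, T. Konno, Kyushu J. Math. 61 (2007) 35–82: §3.1 (3.1), §3.3
  (doi:10.2206/kyushujm.61.35).
-/

noncomputable section

open MeasureTheory Complex SchwartzMap Matrix
open scoped InnerProductSpace ComplexConjugate Real

namespace Literature.RepresentationTheory.KonnoKonno2007

open Literature.Analysis.SegalBargmann Literature.RepresentationTheory.HeisenbergGroup
open Literature.NumberTheory.Weil1964

/-! ## 1. One Gaussian integral: vacuum coefficients of Levi operators are positive

(Generic in the index type `σ`; stated here, in the path namespace of this file, because the generic section file
`ArchVacuumSection` does not import the Levi operators.) -/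

section Gaussian

variable {σ : Type*} [Fintype σ] [DecidableEq σ]

local notation "L2R" σ => Lp ℂ 2 (volume : Measure (σ → ℝ))
local notation "SR" σ => SchwartzMap (σ → ℝ) ℂ

/-- **The vacuum is a positive Gaussian**: `h₀(x) = 2^{n/4} e^{-π Σ x_k²}`, a positive real number at every point.
[cite: Folland1989, §1.7 (1.72)] -/
theorem hermiteFun_herm_zero_eq (x : σ → ℝ) :
    hermiteFun (herm (0 : σ →₀ ℕ)) x = ((vacCoef σ * Real.exp (-(π * ∑ k, x k ^ 2)) : ℝ) : ℂ) := by
  classical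
  simp only [herm_zero, hermiteFun, vac, MvPolynomial.eval_C, gauss]
  push_cast
  ring_nf

omit [DecidableEq σ] in
/-- positivity of the real Gaussian profile. [folklore] -/
theorem vacProfile_pos (x : σ → ℝ) : 0 < vacCoef σ * Real.exp (-(π * ∑ k, x k ^ 2)) :=
  mul_pos vacCoef_pos (Real.exp_pos _)

/-- **Positivity of one Gaussian integral**: if a Schwartz function `g` takes POSITIVE REAL values everywhere, then
`⟪k₀, g⟫_{L²} = ∫ h₀ g > 0`, in particular `≠ 0` (`k₀ = toL2 h₀` the vacuum). [cite: Folland1989, §1.7 (1.72)] -/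
theorem inner_vacL2_toL2_ne_zero_of_pos {g : SR σ} (hg : ∀ x, ∃ r : ℝ, 0 < r ∧ g x = r) :
    ⟪(vacL2 : L2R σ), toL2 g⟫_ℂ ≠ 0 := by
  classical
  rw [← toL2_hermitePi_zero, toL2_hermitePi, inner_hermiteL2_left]
  -- the integrand is (a.e.) the positive real function `F x = ‖g x‖ ‖h₀ x‖`
  set F : (σ → ℝ) → ℝ := fun x => ‖g x‖ * ‖hermitePi (0 : σ →₀ ℕ) x‖ with hF
  have hae : (fun x => (toL2 g : (σ → ℝ) → ℂ) x * conj (hermiteFun (herm (0 : σ →₀ ℕ)) x)) =ᵐ[volume]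
      fun x => ((F x : ℝ) : ℂ) := by
    filter_upwards [coeFn_toL2 g] with x hx
    obtain ⟨r, hr, hgr⟩ := hg x
    rw [hx, hF]
    simp only [hermitePi_apply]
    rw [hgr, hermiteFun_herm_zero_eq, Complex.conj_ofReal, Complex.norm_real, Complex.norm_real,
      Real.norm_of_nonneg hr.le, Real.norm_of_nonneg (vacProfile_pos x).le]
    push_cast
    ring
  have hFpos : ∀ x, 0 < F x := fun x => by
    obtain ⟨r, hr, hgr⟩ := hg x
    rw [hF]
    simp only [hermitePi_apply]
    rw [hgr, hermiteFun_herm_zero_eq, Complex.norm_real, Complex.norm_real, Real.norm_of_nonneg hr.le,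
      Real.norm_of_nonneg (vacProfile_pos x).le]
    exact mul_pos hr (vacProfile_pos x)
  have hFint : Integrable F volume := by
    refine ((SchwartzMap.integrable g).norm.mul_bdd (c := SchwartzMap.seminorm ℂ 0 0 (hermitePi (0 : σ →₀ ℕ)))
      (hermitePi (0 : σ →₀ ℕ)).continuous.norm.aestronglyMeasurable (Filter.Eventually.of_forall fun x => ?_))
    rw [norm_norm]
    exact SchwartzMap.norm_le_seminorm ℂ _ _
  rw [integral_congr_ae hae, integral_complex_ofReal, Ne, Complex.ofReal_eq_zero]
  refine ((integral_pos_iff_support_of_nonneg (fun x => (hFpos x).le) hFint).2 ?_).ne'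
  have hsupp : Function.support F = Set.univ := Set.eq_univ_of_forall fun x => (hFpos x).ne'
  rw [hsupp]
  exact isOpen_univ.measure_pos volume Set.univ_nonempty

/-- **Vacuum coefficients of Levi operators are positive**: `⟪k₀, L(a) h₀⟫ = |det a|^{-1/2} ∫ h₀(x) h₀(a⁻¹ x) dx ≠ 0`.
[cite: Folland1989, (4.24); §1.7 (1.72)] -/
theorem vacCoeffS_leviS_ne_zero (a : (σ → ℝ) ≃ₗ[ℝ] (σ → ℝ)) : vacCoeffS (leviS a) ≠ 0 := by
  refine inner_vacL2_toL2_ne_zero_of_pos fun x => ⟨_, mul_pos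
    (Real.rpow_pos_of_pos (abs_pos.2 (LinearEquiv.isUnit_det' a).ne_zero) (-(1 / 2 : ℝ)))
    (vacProfile_pos (a.symm x)), ?_⟩
  rw [leviS_apply, hermitePi_apply, hermiteFun_herm_zero_eq, leviFactor]
  push_cast
  ring

/-- `unitaryOpPi U` implements `realify U` (the compact-part implementer of `ArchVacuumSection`, restated without a
group homomorphism in the way). [cite: Folland1989, Prop. (4.39)] -/
theorem isImplementerS_unitaryOpPi_realify (U : Matrix.unitaryGroup σ ℂ) :
    IsImplementerS (realify U) (unitaryOpPi U) :=
  isImplementerS_unitaryOpPi (γ := fun U : Matrix.unitaryGroup σ ℂ => realify U) (κ := id) id (fun _ _ => rfl) U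

/-- **Conjugating by `μ₀` does not change vacuum coefficients**: `vacCoeffS (μ₀(u) ∘ X ∘ μ₀(u')) = vacCoeffS X`.
[cite: Folland1989, Prop. (4.39)] -/
theorem vacCoeffS_unitaryOpPi_comp_comp (u u' : Matrix.unitaryGroup σ ℂ) (X : (SR σ) →L[ℂ] SR σ) :
    vacCoeffS (((unitaryOpPi u).comp X).comp (unitaryOpPi u')) = vacCoeffS X :=
  vacCoeffS_comp_comp (isImplementerS_unitaryOpPi_realify u) (unitaryOpPi_hermitePi_zero u)
    (isImplementerS_unitaryOpPi_realify u') (unitaryOpPi_hermitePi_zero u')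

end Gaussian

/-! ## 2. The pair `U(P,Q) × U(R,S)`: vacuum coefficients of the hyperbolic family -/

namespace RealDualPair

open Literature.NumberTheory.Automorphic Literature.NumberTheory.Automorphic.UnitaryGroup

local notation "SR" σ => SchwartzMap (σ → ℝ) ℂ
local notation "PV" σ => (σ → ℝ) × (σ → ℝ)

/-- Notation (NOT a definition): `HasUnitaryLift[σ] A` abbreviates the (w2′) clause shape of
`IsArchWeilDatum.exists_lift`. -/
local notation "HasUnitaryLift[" σ "]" A:max =>
  ∃ U : Lp ℂ 2 (volume : Measure (σ → ℝ)) ≃ₗᵢ[ℂ] Lp ℂ 2 (volume : Measure (σ → ℝ)),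
    LiftsTo A ((LinearIsometryEquiv.toContinuousLinearEquiv U :
        Lp ℂ 2 (volume : Measure (σ → ℝ)) ≃L[ℂ] Lp ℂ 2 (volume : Measure (σ → ℝ))) :
      Lp ℂ 2 (volume : Measure (σ → ℝ)) →L[ℂ] Lp ℂ 2 (volume : Measure (σ → ℝ)))

variable {P Q : Type*} (R S : Type*) [Fintype P] [DecidableEq P] [Fintype Q] [DecidableEq Q] [Fintype R]
  [DecidableEq R] [Fintype S] [DecidableEq S] (p₀ : P) (q₀ : Q)

-- Notation (NOT a definition): the archimedean symplectic action of `G_∞` on the polarised phase space, as phase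
-- maps — `γ𝕎 g = ⇑(ι𝕎 P Q R S g)`.
set_option quotPrecheck false in
local notation "γ𝕎[" P ", " Q ", " R ", " S "]" =>
  fun g : Ginf P Q R S => (⇑((ι𝕎 P Q R S g).1 : (PV (DPIdx P Q R S)) ≃ₗ[ℝ] PV (DPIdx P Q R S)) :
    PhaseMap (DPIdx P Q R S))

/-- **The Levi family has positive vacuum coefficients**: `⟪k₀, hypLevi t h₀⟫ ≠ 0`. [cite: Folland1989, (4.24)] -/
theorem vacCoeffS_hypLevi_ne_zero (t : ℝ) : vacCoeffS (hypLevi R S p₀ q₀ t) ≠ 0 := by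
  unfold hypLevi
  exact vacCoeffS_leviS_ne_zero _

/-- **The hyperbolic implementer family has positive vacuum coefficients**: `⟪k₀, hypOp t h₀⟫ = ⟪k₀, hypLevi t h₀⟫ ≠ 0`
(`hypOp t = μ₀(u)⁻¹ ∘ hypLevi t ∘ μ₀(u)` and `μ₀` fixes the vacuum). [cite: Folland1989, (4.24), Prop. (4.39)] -/
theorem vacCoeffS_hypOp_ne_zero (t : ℝ) : vacCoeffS (hypOp R S p₀ q₀ t) ≠ 0 := by
  rw [hypOp, ← ContinuousLinearMap.comp_assoc, vacCoeffS_unitaryOpPi_comp_comp]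
  exact vacCoeffS_hypLevi_ne_zero R S p₀ q₀ t

/-- `vacCoeffS (hypOp t) = vacCoeffS (hypLevi t)`. [cite: Folland1989, Prop. (4.39)] -/
theorem vacCoeffS_hypOp (t : ℝ) : vacCoeffS (hypOp R S p₀ q₀ t) = vacCoeffS (hypLevi R S p₀ q₀ t) := by
  rw [hypOp, ← ContinuousLinearMap.comp_assoc, vacCoeffS_unitaryOpPi_comp_comp]

/-! ## 3. The `KAK` implementer data of the pair (`|Q| = 1`, `kV R S` onto) -/

/-- `hypOp t` implements `ι𝕎 (hypV t, 1)`. [cite: KonnoKonno2007, §3.1; Folland1989, (4.24)] -/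
theorem isImplementerS_hypOp (t : ℝ) :
    IsImplementerS (γ𝕎[P, Q, R, S] ((hypV p₀ q₀ t : UForm P Q), (1 : UForm R S))) (hypOp R S p₀ q₀ t) :=
  isImplementerS_of_isPhaseCovariantS (isPhaseCovariantS_hypOp_hypV (R := R) (S := S) p₀ q₀)
    (exists_liftsTo_hypOp R S p₀ q₀) t

/-- `ι𝕎 ∘ κ = realify ∘ dualPairι` pointwise on phase space. [cite: KonnoKonno2007, §3.1] -/
theorem ι𝕎_κ_apply (k : DPK P Q R S) (pq : PV (DPIdx P Q R S)) :
    ((ι𝕎 P Q R S (κ P Q R S k)).1 : (PV (DPIdx P Q R S)) ≃ₗ[ℝ] PV (DPIdx P Q R S)) pq = realify (dualPairι k) pq := by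
  rw [ι𝕎_κ]
  rfl

/-- The `KAK` word map of `KAKImplementerData` for `a t = (hypV t, 1)` IS the tree's `kakMapPair`. [folklore] -/
theorem kakWord_eq_kakMapPair :
    (fun p : DPK P Q R S × ℝ × DPK P Q R S =>
        κ P Q R S p.1 * ((hypV p₀ q₀ p.2.1 : UForm P Q), (1 : UForm R S)) * κ P Q R S p.2.2) =
      kakMapPair (R := R) (S := S) p₀ q₀ := by
  funext ⟨k, t, k'⟩
  rw [kakMapPair_apply, φ_slExp]

/-- **The `KAK` implementer data of the real unitary dual pair** `U(P,Q) × U(R,S)` of real rank one in the first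
factor (`|Q| = 1`) with `kV R S : U(R) × U(S) → U(R,S)` onto: compact part `μ₀ ∘ dualPairι` on
`K = (U(P) × U(Q)) × (U(R) × U(S))`, hyperbolic part `hypOp` along `t ↦ (hypV t, 1)`, proper surjective word map
`kakMapPair`. [cite: Folland1989, §4.2 (4.24), Prop. (4.39); Knapp2002, Thm 7.39; KonnoKonno2007, §3.1] -/
theorem kakImplementerData_junction [Subsingleton Q] (hW : Function.Surjective (UForm.kV R S)) :
    KAKImplementerData (γ𝕎[P, Q, R, S]) (κ P Q R S)
      (fun t : ℝ => (((hypV p₀ q₀ t : UForm P Q), (1 : UForm R S)) : Ginf P Q R S))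
      (fun k : DPK P Q R S => unitaryOpPi (dualPairι k)) (hypOp R S p₀ q₀) := by
  refine kakImplementerData_unitaryOpPi (γ := γ𝕎[P, Q, R, S]) (symplecticPhaseMap_mul (ι𝕎 P Q R S)) dualPairι
    continuous_dualPairι (fun k pq => ι𝕎_κ_apply R S k pq) (isImplementerS_hypOp R S p₀ q₀)
    (vacCoeffS_hypOp_ne_zero R S p₀ q₀) (continuous_hypOp_uncurry R S p₀ q₀) ?_ ?_
  · rw [kakWord_eq_kakMapPair]
    exact isProperMap_kakMapPair p₀ q₀
  · rw [kakWord_eq_kakMapPair]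
    exact kakMapPair_surjective p₀ q₀ hW

/-! ## 4. Consequences: (w0), (w1), (w2), (w2′) for the canonical section of the pair -/

section Consequences

variable [Nonempty P] [Subsingleton Q] [Nonempty Q] (hW : Function.Surjective (UForm.kV R S))
include hW

/-- the `KAK` implementer data along the plane of two arbitrarily chosen basis vectors `e_{p₀} ∈ P`, `e_{q₀} ∈ Q`
(the consequences below do not depend on the choice). [cite: Knapp2002, Thm 7.39] -/
theorem kakImplementerData_junction_arbitrary :
    KAKImplementerData (γ𝕎[P, Q, R, S]) (κ P Q R S)
      (fun t : ℝ => (((hypV (Classical.arbitrary P) (Classical.arbitrary Q) t : UForm P Q), (1 : UForm R S)) :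
        Ginf P Q R S))
      (fun k : DPK P Q R S => unitaryOpPi (dualPairι k))
      (hypOp R S (Classical.arbitrary P) (Classical.arbitrary Q)) :=
  kakImplementerData_junction R S _ _ hW

/-- **(w2) Heisenberg covariance of the canonical section over `ι𝕎`**, in the tree's family currency.
[cite: Folland1989, §4.2, the Schur remark p. 156; KonnoKonno2007, §3.1] -/
theorem isPhaseCovariantS_vacSection_junction :
    IsPhaseCovariantS (γ𝕎[P, Q, R, S])
      (fun g => ((vacSection (γ𝕎[P, Q, R, S]) g : (SR (DPIdx P Q R S)) →L[ℂ] SR (DPIdx P Q R S)) :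
        (SR (DPIdx P Q R S)) →ₗ[ℂ] SR (DPIdx P Q R S))) :=
  (kakImplementerData_junction_arbitrary R S hW).isPhaseCovariantS_vacSection

/-- **(w2′) unitary `L²`-lifts of the canonical section.** [cite: Folland1989, Prop. (4.39)] -/
theorem hasUnitaryLift_vacSection_junction (g : Ginf P Q R S) :
    HasUnitaryLift[DPIdx P Q R S]
      ((vacSection (γ𝕎[P, Q, R, S]) g : (SR (DPIdx P Q R S)) →L[ℂ] SR (DPIdx P Q R S)) :
        (SR (DPIdx P Q R S)) →ₗ[ℂ] SR (DPIdx P Q R S)) :=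
  (kakImplementerData_junction_arbitrary R S hW).hasUnitaryLift_vacSection g

/-- the canonical section implements `ι𝕎 g` at every `g`. [cite: Folland1989, §4.2 p. 156] -/
theorem isImplementerS_vacSection_junction (g : Ginf P Q R S) :
    IsImplementerS (γ𝕎[P, Q, R, S] g) (vacSection (γ𝕎[P, Q, R, S]) g) :=
  (kakImplementerData_junction_arbitrary R S hW).isImplementerS_vacSection g

/-- **(w0) the canonical section is nowhere the zero operator.** [cite: Folland1989, Prop. (4.39)] -/
theorem vacSection_junction_ne_zero (g : Ginf P Q R S) : vacSection (γ𝕎[P, Q, R, S]) g ≠ 0 :=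
  (kakImplementerData_junction_arbitrary R S hW).vacSection_ne_zero g

/-- the canonical section kills no non-zero Schwartz function. [cite: Folland1989, Prop. (4.39)] -/
theorem vacSection_junction_apply_ne_zero (g : Ginf P Q R S) {f : SR (DPIdx P Q R S)} (hf : f ≠ 0) :
    vacSection (γ𝕎[P, Q, R, S]) g f ≠ 0 :=
  (kakImplementerData_junction_arbitrary R S hW).vacSection_apply_ne_zero g hf

/-- its vacuum coefficient is a positive real: `⟪k₀, N(g) k₀⟫ = ‖⟪k₀, N(g) k₀⟫‖ ≠ 0`. [cite: Folland1989, Prop. (4.39)] -/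
theorem vacCoeffS_vacSection_junction (g : Ginf P Q R S) :
    vacCoeffS (vacSection (γ𝕎[P, Q, R, S]) g) = (‖vacCoeffS (vacSection (γ𝕎[P, Q, R, S]) g)‖ : ℂ) ∧
      vacCoeffS (vacSection (γ𝕎[P, Q, R, S]) g) ≠ 0 :=
  ⟨(kakImplementerData_junction_arbitrary R S hW).vacCoeffS_vacSection_eq_norm g,
    (kakImplementerData_junction_arbitrary R S hW).vacCoeffS_vacSection_ne_zero g⟩

/-- **(w1) JOINT continuity of the canonical section** `G_∞ × 𝓢 → 𝓢`.
[cite: Folland1989, §4.2, the Schur remark p. 156, Prop. (4.39); Knapp2002, Thm 7.39] -/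
theorem continuous_uncurry_vacSection_junction :
    Continuous fun x : Ginf P Q R S × SR (DPIdx P Q R S) => vacSection (γ𝕎[P, Q, R, S]) x.1 x.2 :=
  (kakImplementerData_junction_arbitrary R S hW).continuous_uncurry_vacSection

/-- (w1) in the orbit form: `g ↦ N(g) f` is continuous for every `f`. [cite: Folland1989, §4.2 p. 156] -/
theorem continuous_apply_vacSection_junction (f : SR (DPIdx P Q R S)) :
    Continuous fun g : Ginf P Q R S => vacSection (γ𝕎[P, Q, R, S]) g f :=
  (kakImplementerData_junction_arbitrary R S hW).continuous_apply_vacSection f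

/-- **On the maximal compact the canonical section IS Folland's `μ₀`**: `N(κ k) = unitaryOpPi (dualPairι k)`.
[cite: Folland1989, Prop. (4.39); KonnoKonno2007, §3.1] -/
theorem vacSection_junction_κ (k : DPK P Q R S) :
    vacSection (γ𝕎[P, Q, R, S]) (κ P Q R S k) = unitaryOpPi (dualPairι k) :=
  (kakImplementerData_junction_arbitrary R S hW).vacSection_κ k

/-- in particular the canonical section FIXES THE VACUUM on the maximal compact: `N(κ k) h₀ = h₀`.
[cite: Folland1989, Prop. (4.39)] -/
theorem vacSection_junction_κ_hermitePi_zero (k : DPK P Q R S) :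
    vacSection (γ𝕎[P, Q, R, S]) (κ P Q R S k) (hermitePi 0) = hermitePi 0 := by
  rw [vacSection_junction_κ R S hW, unitaryOpPi_hermitePi_zero]

/-- `K`-bi-equivariance: `N(κ k₁ · g · κ k₂) = μ₀(k₁) ∘ N(g) ∘ μ₀(k₂)`. [cite: Folland1989, Prop. (4.39)] -/
theorem vacSection_junction_κ_mul_mul_κ (k₁ : DPK P Q R S) (g : Ginf P Q R S) (k₂ : DPK P Q R S) :
    vacSection (γ𝕎[P, Q, R, S]) (κ P Q R S k₁ * g * κ P Q R S k₂) =
      ((unitaryOpPi (dualPairι k₁)).comp (vacSection (γ𝕎[P, Q, R, S]) g)).comp (unitaryOpPi (dualPairι k₂)) :=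
  (kakImplementerData_junction_arbitrary R S hW).vacSection_κ_mul_mul_κ k₁ g k₂

end Consequences

/-- on the hyperbolic family the canonical section is the vacuum-normalised `hypOp`:
`N((hypV t, 1)) = (‖c_t‖/c_t) • hypOp t`, `c_t = ⟪k₀, hypLevi t h₀⟫` (for ANY plane `{e_{p₀}, e_{q₀}}`, no rank
hypothesis). [cite: Folland1989, (4.24), Prop. (4.39)] -/
theorem vacSection_junction_hypV (t : ℝ) :
    vacSection (γ𝕎[P, Q, R, S]) (((hypV p₀ q₀ t : UForm P Q), (1 : UForm R S)) : Ginf P Q R S) =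
      ((‖vacCoeffS (hypLevi R S p₀ q₀ t)‖ : ℂ) / vacCoeffS (hypLevi R S p₀ q₀ t)) • hypOp R S p₀ q₀ t := by
  rw [vacSection_eq_vnormS (γ := γ𝕎[P, Q, R, S]) (g := (((hypV p₀ q₀ t : UForm P Q), (1 : UForm R S)) : Ginf P Q R S))
    (isImplementerS_hypOp R S p₀ q₀ t) (vacCoeffS_hypOp_ne_zero R S p₀ q₀ t), vnormS, vacCoeffS_hypOp]

/-! ## 5. Definite second factor: `S = ∅` or `R = ∅` -/

/-- **(w1) for `U(P,Q) × U(R)`** (`S` empty). [cite: Folland1989, §4.2 p. 156; Knapp2002, Thm 7.39] -/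
theorem continuous_uncurry_vacSection_junction_of_isEmpty_right [Nonempty P] [Subsingleton Q] [Nonempty Q]
    [IsEmpty S] :
    Continuous fun x : Ginf P Q R S × SR (DPIdx P Q R S) => vacSection (γ𝕎[P, Q, R, S]) x.1 x.2 :=
  continuous_uncurry_vacSection_junction R S UForm.kV_surjective_of_isEmpty_right

/-- **(w1) for `U(P,Q) × U(S)`** (`R` empty). [cite: Folland1989, §4.2 p. 156; Knapp2002, Thm 7.39] -/
theorem continuous_uncurry_vacSection_junction_of_isEmpty_left [Nonempty P] [Subsingleton Q] [Nonempty Q]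
    [IsEmpty R] :
    Continuous fun x : Ginf P Q R S × SR (DPIdx P Q R S) => vacSection (γ𝕎[P, Q, R, S]) x.1 x.2 :=
  continuous_uncurry_vacSection_junction R S UForm.kV_surjective_of_isEmpty_left

/-! ## 6. The adjudicated currency `(Fin 2, Unit, Unit, Empty)`: `U(2,1) × U(1)` -/

/-- **The canonical archimedean family at `ι₁`**: for `G_∞ = U(2,1) × U(1)` acting on `𝓢(ℝ³)` through `ι𝕎`, the
vacuum-normalised implementer section is jointly continuous, Heisenberg-covariant with unitary lifts, and nowhere
zero — hypotheses (w0)–(w2) of `hasThetaMajorants_omega_comp` at the real place, with NO representation assumed.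
[cite: KonnoKonno2007, §3.3; Folland1989, §4.2 p. 156, Prop. (4.39)] -/
theorem vacSection_ι₁ :
    (Continuous fun x : Ginf (Fin 2) Unit Unit Empty × SR (DPIdx (Fin 2) Unit Unit Empty) =>
        vacSection (γ𝕎[Fin 2, Unit, Unit, Empty]) x.1 x.2) ∧
      IsPhaseCovariantS (γ𝕎[Fin 2, Unit, Unit, Empty])
        (fun g => ((vacSection (γ𝕎[Fin 2, Unit, Unit, Empty]) g :
            (SR (DPIdx (Fin 2) Unit Unit Empty)) →L[ℂ] SR (DPIdx (Fin 2) Unit Unit Empty)) :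
          (SR (DPIdx (Fin 2) Unit Unit Empty)) →ₗ[ℂ] SR (DPIdx (Fin 2) Unit Unit Empty))) ∧
      (∀ g, HasUnitaryLift[DPIdx (Fin 2) Unit Unit Empty]
        ((vacSection (γ𝕎[Fin 2, Unit, Unit, Empty]) g :
            (SR (DPIdx (Fin 2) Unit Unit Empty)) →L[ℂ] SR (DPIdx (Fin 2) Unit Unit Empty)) :
          (SR (DPIdx (Fin 2) Unit Unit Empty)) →ₗ[ℂ] SR (DPIdx (Fin 2) Unit Unit Empty))) ∧
      ∀ g, vacSection (γ𝕎[Fin 2, Unit, Unit, Empty]) g ≠ 0 :=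
  ⟨continuous_uncurry_vacSection_junction Unit Empty UForm.kV_surjective_of_isEmpty_right,
    isPhaseCovariantS_vacSection_junction Unit Empty UForm.kV_surjective_of_isEmpty_right,
    hasUnitaryLift_vacSection_junction Unit Empty UForm.kV_surjective_of_isEmpty_right,
    vacSection_junction_ne_zero Unit Empty UForm.kV_surjective_of_isEmpty_right⟩

end RealDualPair

end Literature.RepresentationTheory.KonnoKonno2007
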